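import Mathlib
import Literature.MathematicalPhysics.QuantumFieldTheory.Luscher2010.TrivializingMaps
import Literature.MathematicalPhysics.QuantumFieldTheory.Luscher2010.FlowActionSeries
import Summits.Ventures.LatticeQCDFlow.TrivializingMaps.Truncation
import Summits.Ventures.LatticeQCDFlow.TrivializingMaps.ExtensiveDefectReduction
import Summits.Ventures.LatticeQCDFlow.TrivializingMaps.WilsonGradientBound
import Summits.Ventures.LatticeQCDFlow.TrivializingMaps.GradientControl
import Summits.Ventures.LatticeQCDFlow.TrivializingMaps.LinkTransport
import HarnessLib

/-!
# The volume law `ExtensiveDefect d n N` — PROVED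

HONEST FRAMING: exact (Metropolis-corrected) sampling algorithms for lattice gauge theory; figures of merit are
autocorrelation/cost numbers at stated couplings and volumes; no continuum-physics claim.

Lüscher, CMP 293 (2010) 899, §4.3–4.5: the order-`N` truncation defect `𝓥 S̃^{(N)} = ∑_{e,a} ∂^a_e S_W ∂^a_e S̃^{(N)}`
of the flow-action series of the Wilson action is a sum of LOCAL loop functionals with VOLUME-INDEPENDENT
coefficients, hence `sup_U |𝓥 S̃^{(N)}(U)| ≤ b_N · |E|` with `b_N` independent of the lattice size. This file proves
the typed venture target `ExtensiveDefect d n N` (`Truncation.lean` §4) for all `d, n, N` (`extensiveDefect_holds`),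
discharging input (A) of `ExtensiveDefectReduction.extensiveDefect_of` (input (W) is `wilsonGradBound`):

* §1 `solverGradUniform` — ONE constant `K = K(d, n, m, R)` such that on EVERY lattice `L`, for every basis `B`
  and anchor `e₀`, a link polynomial `u ∈ PD m (linkBall R e₀)` with `|Δ_B u| ≤ M` on `SU(n)^E` has
  `|∂_{e,Y} u| ≤ K·M` on `SU(n)^E` (unit `Y ∈ 𝔰𝔲(n)`). Proof: the plaquette ball has at most `(1+16d²)^R` links
  (`card_filter_linkBall_le`), so it embeds — together with one junk link — into the FIXED reference lattice
  `Edge 1 L₀`, `L₀ = (1+16d²)^R + 1`; the transport `τ_*` of `LinkTransport` commutes with `∂` and `Δ` and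
  preserves the degree, and on the reference lattice `GradientControl.gradient_control` applies.
* §2 volume-uniform VALUE bounds: `|Re tr(1 - U_p)| ≤ P` on `SU(n)^4` (compactness), `|s_e(ιU)| ≤ d·P` for the
  anchored plaquette sums, `|g(ιU) - ⟨g⟩| ≤ 2G` for the mean-subtracted right-hand sides.
* §3 `anchTermGradBound` — by induction on the order `k`: `G^{(k)}_{e₀}` solves `Δ G = g - ⟨g⟩` in
  `PD (4(k+1)) (linkBall (k+1) e₀)` with `|g| ≤ G_k` uniformly (`G_0 = d·P`;
  `G_{k+1} = (1+16d²)^{k+1} · dim_ℝ M_n(ℂ) · c_W · c_k` from the recursion `g = -∑_{e',a} ∂S_W ∂G^{(k)}`), hence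
  `|∂_{e,Y} G^{(k)}_{e₀}| ≤ c_k := K(d,n,4(k+1),k+1) · 2G_k`, uniformly in `L, B, e₀, e, Y, U`.
* §4 `extensiveDefect_holds : ExtensiveDefect d n N`.

With `TruncatedMapLogWeightBound` (`LuscherSection3Unconditional.truncatedMapLogWeightBound_holds`) this makes the
order-`N` log-weight / acceptance volume law of the truncated Lüscher map unconditional: log-oscillation
`≤ 2 b_N |E| / (N+2)` at `β = 1` (`β^{N+2}` in general, `IsLuscherSeries.smul`). The constants are those of the
proof (finite-dimensional compactness), not Lüscher's sharp spectral-gap constants — no claim on their size.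
Reference: M. Lüscher, CMP 293 (2010) 899 [Luscher2010Trivializing, arXiv:0907.5491], §4.2 (gap of `Δ`),
§4.3 eqs. (4.14)–(4.15), §4.4, §4.5(a)–(c).
-/

namespace Summit.Ventures.LatticeQCDFlow.TrivializingMaps

open MeasureTheory
open Literature.MathematicalPhysics.QuantumFieldTheory
open Literature.MathematicalPhysics.QuantumFieldTheory.Luscher2010
open scoped Matrix Matrix.Norms.Frobenius ContDiff

noncomputable section

attribute [local instance] Classical.propDecidable

variable {d L n : ℕ}

/-! ## §1. Volume-uniform gradient control for `Δ⁻¹` on plaquette balls -/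

/-- The reference lattice `Edge 1 L₀` has exactly `L₀` links. [folklore] -/
theorem card_edge_one (L₀ : ℕ) [NeZero L₀] : Fintype.card (Edge 1 L₀) = L₀ := by
  simp [Fintype.card_prod, ZMod.card]

/-- **Separating link maps into the reference lattice.** A finite link set `A` with `|A| + 1 ≤ L₀` is separated
(`τ e₂ = τ e ⇒ e₂ = e` for `e ∈ A`) by some link map `τ : Edge d L → Edge 1 L₀` (embed `A`, send the rest to one
spare link). [folklore] -/
theorem exists_separating_map [NeZero L] (A : Set (Edge d L)) (L₀ : ℕ) [NeZero L₀]
    (hcard : (Finset.univ.filter (fun e : Edge d L => e ∈ A)).card + 1 ≤ L₀) :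
    ∃ τ : Edge d L → Edge 1 L₀, ∀ e ∈ A, ∀ e₂, τ e₂ = τ e → e₂ = e := by
  set Af := Finset.univ.filter (fun e : Edge d L => e ∈ A) with hAf
  have hc : Fintype.card (Option ↥Af) ≤ Fintype.card (Edge 1 L₀) := by
    rw [Fintype.card_option, Fintype.card_coe, card_edge_one]
    exact hcard
  obtain ⟨ψ⟩ := Function.Embedding.nonempty_iff_card_le.2 hc
  have hmem : ∀ e, e ∈ A → e ∈ Af := fun e he => by simp [hAf, he]
  refine ⟨fun e => if h : e ∈ A then ψ (some ⟨e, hmem e h⟩) else ψ none, fun e he e₂ h => ?_⟩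
  by_cases h₂ : e₂ ∈ A
  · simp only [dif_pos h₂, dif_pos he] at h
    have h3 := ψ.injective h
    simp only [Option.some.injEq, Subtype.mk.injEq] at h3
    exact h3
  · simp only [dif_neg h₂, dif_pos he] at h
    exact absurd (ψ.injective h) (by simp)

/-- **Volume-uniform gradient control by the Laplacian on plaquette balls.** For all `d, n, m, R` there is
`K ≥ 0` such that on EVERY periodic lattice, for every basis `B`, anchor `e₀` and `u ∈ PD m (linkBall R e₀)`:
if `|Δ_B u| ≤ M` on `SU(n)^E` then `|∂_{e,Y} u| ≤ K·M` on `SU(n)^E` for all links `e` and unit `Y ∈ 𝔰𝔲(n)`.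
(Transport to the reference lattice `Edge 1 ((1+16d²)^R + 1)` + `gradient_control` there.)
[cite: Luscher2010Trivializing, §4.2 (gap of Δ), §4.4–§4.5 (volume independence of the local terms)] -/
theorem solverGradUniform (d n m R : ℕ) : ∃ K : ℝ, 0 ≤ K ∧ ∀ (L : ℕ) [NeZero L] (B : SuBasis n) (e₀ : Edge d L)
    (u : AmbConfig d L n → ℝ), u ∈ PD (n := n) m (linkBall R e₀) → ∀ M : ℝ, 0 ≤ M →
      (∀ U : GaugeConfig d L (Matrix.specialUnitaryGroup (Fin n) ℂ), |linkLap B u (WilsonFlow.coeConfig U)| ≤ M) →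
      ∀ (e : Edge d L) (Y : Matrix (Fin n) (Fin n) ℂ), Y ∈ suAlgebra n → ‖Y‖ ≤ 1 →
      ∀ U : GaugeConfig d L (Matrix.specialUnitaryGroup (Fin n) ℂ),
        |linkDeriv e Y u (WilsonFlow.coeConfig U)| ≤ K * M := by
  set L₀ := (1 + 16 * (d * d)) ^ R + 1 with hL₀
  haveI : NeZero L₀ := ⟨Nat.succ_ne_zero _⟩
  obtain ⟨K, hK0, hK⟩ := gradient_control 1 L₀ n m
  refine ⟨K, hK0, fun L _ B e₀ u hu M hM hΔ e Y hY hY1 U => ?_⟩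
  obtain ⟨τ, hτ⟩ := exists_separating_map (linkBall R e₀) L₀
    (Nat.succ_le_succ (card_filter_linkBall_le e₀ R))
  by_cases he : e ∈ linkBall R e₀
  · obtain ⟨U', hU'⟩ := exists_linkDeriv_eq_pushFun (n := n) τ hτ hu.2 he Y U
    rw [hU']
    exact hK B (pushFun τ u) (pushFun_mem_polyL τ hu.1) M hM (abs_linkLap_pushFun_le B τ hτ hu.2 hΔ)
      (τ e) Y hY hY1 U'
  · rw [linkDeriv_eq_zero_of_not_mem Y hu.2 he, abs_zero]
    exact mul_nonneg hK0 hM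

/-! ## §2. Volume-uniform value bounds -/

/-- `|Re tr(1 - A₀A₁A₂ᴴA₃ᴴ)| ≤ P` for `A ∈ SU(n)^4` (a continuous function on a compact set). [folklore] -/
theorem exists_bound_refPlaq : ∃ P : ℝ, 0 ≤ P ∧ ∀ A : Fin 4 → Matrix (Fin n) (Fin n) ℂ,
    (∀ i, A i ∈ Set.range (Subtype.val : ↥(Matrix.specialUnitaryGroup (Fin n) ℂ) → Matrix (Fin n) (Fin n) ℂ)) →
      |refPlaq n A| ≤ P := by
  have hC : IsCompact (Set.pi Set.univ fun _ : Fin 4 =>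
      Set.range (Subtype.val : ↥(Matrix.specialUnitaryGroup (Fin n) ℂ) → Matrix (Fin n) (Fin n) ℂ)) :=
    isCompact_univ_pi fun _ => isCompact_range continuous_subtype_val
  obtain ⟨P, hP⟩ := hC.exists_bound_of_continuousOn (contDiff_refPlaq (n := n) (m := 0)).continuous.continuousOn
  refine ⟨max P 0, le_max_right _ _, fun A hA => ?_⟩
  have h := hP A (Set.mem_univ_pi.2 hA)
  rw [Real.norm_eq_abs] at h
  exact h.trans (le_max_left _ _)

/-- **The anchored plaquette sums are bounded uniformly in the volume**: `|s_e(ιU)| ≤ d·P` (at most `d` plaquettes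
are anchored at a link, each bounded by `P` on `SU(n)^4`). [cite: Luscher2010Trivializing, §4.4 eq. (4.16)] -/
theorem anchorS_bound (d n : ℕ) : ∃ A₀ : ℝ, 0 ≤ A₀ ∧ ∀ (L : ℕ) [NeZero L] (e : Edge d L)
    (U : GaugeConfig d L (Matrix.specialUnitaryGroup (Fin n) ℂ)), |anchorS e (WilsonFlow.coeConfig U)| ≤ A₀ := by
  obtain ⟨P, hP0, hP⟩ := exists_bound_refPlaq (n := n)
  refine ⟨d * P, by positivity, fun L _ e U => ?_⟩
  unfold anchorS
  calc |∑ ν ∈ Finset.univ.filter (fun ν => e.2 < ν), plaqRe e.1 e.2 ν (WilsonFlow.coeConfig U)|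
      ≤ ∑ ν ∈ Finset.univ.filter (fun ν => e.2 < ν), |plaqRe e.1 e.2 ν (WilsonFlow.coeConfig U)| :=
        Finset.abs_sum_le_sum_abs _ _
    _ ≤ ∑ _ν ∈ Finset.univ.filter (fun ν => e.2 < ν), P := Finset.sum_le_sum fun ν _ => by
        rw [plaqRe_eq_comp, Function.comp_apply]
        exact hP _ fun i => ⟨U (plaqIdx e.1 e.2 ν i), rfl⟩
    _ = (Finset.univ.filter (fun ν => e.2 < ν)).card * P := by rw [Finset.sum_const, nsmul_eq_mul]
    _ ≤ d * P := by
        gcongr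
        exact (Finset.card_filter_le _ _).trans (by simp)

/-- Mean-subtracted right-hand sides: `|g(ιU) - ⟨g⟩| ≤ 2G` when `|g| ≤ G` on `SU(n)^E` (`D[U]` is a probability
measure). [folklore] -/
theorem abs_sub_integral_le [NeZero L] {g : AmbConfig d L n → ℝ} {G : ℝ}
    (hG : ∀ U : GaugeConfig d L (Matrix.specialUnitaryGroup (Fin n) ℂ), |g (WilsonFlow.coeConfig U)| ≤ G)
    (U : GaugeConfig d L (Matrix.specialUnitaryGroup (Fin n) ℂ)) :
    |g (WilsonFlow.coeConfig U) - ∫ U', g (WilsonFlow.coeConfig U')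
        ∂(trivialMeasure (Matrix.specialUnitaryGroup (Fin n) ℂ) d L)| ≤ 2 * G := by
  have h1 : |∫ U', g (WilsonFlow.coeConfig U') ∂(trivialMeasure (Matrix.specialUnitaryGroup (Fin n) ℂ) d L)| ≤ G := by
    have h := norm_integral_le_of_norm_le_const
      (μ := trivialMeasure (Matrix.specialUnitaryGroup (Fin n) ℂ) d L)
      (f := fun U' : GaugeConfig d L (Matrix.specialUnitaryGroup (Fin n) ℂ) => g (WilsonFlow.coeConfig U'))
      (C := G) (Filter.Eventually.of_forall fun U' => by rw [Real.norm_eq_abs]; exact hG U')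
    simpa [Real.norm_eq_abs] using h
  calc _ ≤ |g (WilsonFlow.coeConfig U)| +
        |∫ U', g (WilsonFlow.coeConfig U') ∂(trivialMeasure (Matrix.specialUnitaryGroup (Fin n) ℂ) d L)| :=
        abs_sub _ _
    _ ≤ G + G := add_le_add (hG U) h1
    _ = 2 * G := by ring

/-- **Volume-uniform bound on Lüscher's bilinear right-hand side**: if `f` depends only on `linkBall (k+1) e₀` and
has unit-direction link gradients `≤ c` on `SU(n)^E`, then
`|∑_{e',a} ∂^a_{e'} S_W ∂^a_{e'} f| ≤ (1+16d²)^{k+1}·dim·c_W·c` on `SU(n)^E`.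
[cite: Luscher2010Trivializing, §4.3 eq. (4.15), §4.5(a)] -/
theorem abs_wilsonRhs_le [NeZero L] (B : SuBasis n) {k : ℕ} {e₀ : Edge d L} {f : AmbConfig d L n → ℝ}
    (hf : f ∈ depOn (n := n) (linkBall (k + 1) e₀)) {cW c : ℝ} (hcW : 0 ≤ cW) (hc : 0 ≤ c)
    (hW : ∀ (e : Edge d L) (Y : Matrix (Fin n) (Fin n) ℂ), Y ∈ suAlgebra n → ‖Y‖ ≤ 1 →
      ∀ U : GaugeConfig d L (Matrix.specialUnitaryGroup (Fin n) ℂ),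
        |linkDeriv e Y (ambWilsonAction : AmbConfig d L n → ℝ) (WilsonFlow.coeConfig U)| ≤ cW)
    (hF : ∀ (e : Edge d L) (Y : Matrix (Fin n) (Fin n) ℂ), Y ∈ suAlgebra n → ‖Y‖ ≤ 1 →
      ∀ U : GaugeConfig d L (Matrix.specialUnitaryGroup (Fin n) ℂ), |linkDeriv e Y f (WilsonFlow.coeConfig U)| ≤ c)
    (U : GaugeConfig d L (Matrix.specialUnitaryGroup (Fin n) ℂ)) :
    |wilsonRhs B f (WilsonFlow.coeConfig U)| ≤
      (1 + 16 * (d * d)) ^ (k + 1) * (Module.finrank ℝ (Matrix (Fin n) (Fin n) ℂ) * (cW * c)) := by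
  unfold wilsonRhs
  have hKnn : 0 ≤ (Module.finrank ℝ (Matrix (Fin n) (Fin n) ℂ) : ℝ) * (cW * c) := by positivity
  refine abs_sum_linkBall_le (k + 1) e₀ _ hKnn (fun e' he' => ?_) (fun e' => ?_)
  · refine Finset.sum_eq_zero fun a _ => ?_
    rw [linkDeriv_eq_zero_of_not_mem (B.T a) hf he', mul_zero]
  · calc |∑ a : B.ι, linkDeriv e' (B.T a) (ambWilsonAction : AmbConfig d L n → ℝ) (WilsonFlow.coeConfig U) *
            linkDeriv e' (B.T a) f (WilsonFlow.coeConfig U)|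
        ≤ ∑ a : B.ι, |linkDeriv e' (B.T a) (ambWilsonAction : AmbConfig d L n → ℝ) (WilsonFlow.coeConfig U) *
            linkDeriv e' (B.T a) f (WilsonFlow.coeConfig U)| := Finset.abs_sum_le_sum_abs _ _
      _ ≤ ∑ _a : B.ι, cW * c := Finset.sum_le_sum fun a _ => by
          rw [abs_mul]
          exact mul_le_mul (hW e' (B.T a) (B.mem a) (suBasis_norm_le_one B a) U)
            (hF e' (B.T a) (B.mem a) (suBasis_norm_le_one B a) U) (abs_nonneg _) hcW
      _ = Fintype.card B.ι * (cW * c) := by rw [Finset.sum_const, nsmul_eq_mul, Finset.card_univ]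
      _ ≤ Module.finrank ℝ (Matrix (Fin n) (Fin n) ℂ) * (cW * c) := by
          have hWA : 0 ≤ cW * c := mul_nonneg hcW hc
          gcongr
          exact_mod_cast suBasis_card_le B

/-! ## §3. Input (A): volume-uniform gradient bounds for the anchored terms, by induction on the order -/

/-- **Input (A) of `extensiveDefect_of`, PROVED**: for all `d, n, k` there is `c_k ≥ 0` with
`|∂_{e,Y} G^{(k)}_{e₀}(ιU)| ≤ c_k` for every lattice `L`, basis `B`, anchor `e₀`, link `e`, unit `Y ∈ 𝔰𝔲(n)` and
`U ∈ SU(n)^E`. [cite: Luscher2010Trivializing, §4.3 eqs. (4.14)–(4.15), §4.5(a)–(b)] -/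
theorem anchTermGradBound (d n : ℕ) : ∀ k : ℕ, ∃ c : ℝ, 0 ≤ c ∧ ∀ (L : ℕ) [NeZero L] (B : SuBasis n)
    (e₀ e : Edge d L) (Y : Matrix (Fin n) (Fin n) ℂ), Y ∈ suAlgebra n → ‖Y‖ ≤ 1 →
      ∀ U : GaugeConfig d L (Matrix.specialUnitaryGroup (Fin n) ℂ),
        |linkDeriv e Y (anchTerm B k e₀) (WilsonFlow.coeConfig U)| ≤ c
  | 0 => by
    obtain ⟨K, hK0, hK⟩ := solverGradUniform d n (4 * (0 + 1)) (0 + 1)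
    obtain ⟨A₀, hA0, hA⟩ := anchorS_bound d n
    refine ⟨K * (2 * A₀), by positivity, fun L _ B e₀ e Y hY hY1 U => ?_⟩
    refine hK L B e₀ (anchTerm B 0 e₀) (anchTerm_mem B 0 e₀) (2 * A₀) (by positivity) (fun U' => ?_) e Y hY hY1 U
    rw [anchTerm_zero, linkLap_solvePD]
    exact abs_sub_integral_le (fun U'' => hA L e₀ U'') U'
  | k + 1 => by
    obtain ⟨c, hc0, hc⟩ := anchTermGradBound d n k
    obtain ⟨K, hK0, hK⟩ := solverGradUniform d n (4 * (k + 1 + 1)) (k + 1 + 1)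
    obtain ⟨cW, hcW0, hcW⟩ := wilsonGradBound d n
    refine ⟨K * (2 * ((1 + 16 * (d * d)) ^ (k + 1) * (Module.finrank ℝ (Matrix (Fin n) (Fin n) ℂ) * (cW * c)))),
      by positivity, fun L _ B e₀ e Y hY hY1 U => ?_⟩
    refine hK L B e₀ (anchTerm B (k + 1) e₀) (anchTerm_mem B (k + 1) e₀) _ (by positivity) (fun U' => ?_)
      e Y hY hY1 U
    rw [anchTerm_succ, linkLap_solvePD]
    refine abs_sub_integral_le (fun U'' => ?_) U'
    rw [Pi.neg_apply, abs_neg]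
    exact abs_wilsonRhs_le B (dependsOn_anchTerm B k e₀) hcW0 hc0 (fun e' Y' hY' hY1' U₁ => hcW L e' Y' hY' hY1' U₁)
      (fun e' Y' hY' hY1' U₁ => hc L B e₀ e' Y' hY' hY1' U₁) U''

/-! ## §4. The volume law -/

/-- **`ExtensiveDefect d n N` holds for all `d, n, N`**: there is `b_N = b_N(d, n)`, independent of the lattice size
and of the basis, with `sup_U |𝓥 S̃^{(N)}(U)| ≤ b_N · |E|` for EVERY smooth Lüscher series of the Wilson action on
every periodic lattice `(ℤ/L)^d`. [cite: Luscher2010Trivializing, §4.3 eqs. (4.14)–(4.15), §4.5(a)–(c)] -/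
theorem extensiveDefect_holds (d n N : ℕ) : ExtensiveDefect d n N := by
  obtain ⟨cW, hcW0, hcW⟩ := wilsonGradBound d n
  obtain ⟨cA, hcA0, hcA⟩ := anchTermGradBound d n N
  exact extensiveDefect_of N hcW0 hcA0 (fun L _ e Y hY hY1 U => hcW L e Y hY hY1 U)
    (fun L _ B e₀ e Y hY hY1 U => hcA L B e₀ e Y hY hY1 U)

end

end Summit.Ventures.LatticeQCDFlow.TrivializingMaps
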